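/-
Origin: expansion seat `planner-pub-hodgecm-mc-axioms-1-g14-0`, handover #W147 2026-08-20T15:53:55Z md5 ee04c857684a (PKG 34a5e1c4a59d → ee04c857684a; 84 l.; MECHANICAL (iib-R) rewrite v3.1 of the PKG file as it stands (22 token edits; rules R1x1+RX[h₂]x21)) (`HOME/mc/pub-hodgecm-mc-axioms-1-g14/revendor/kit-r55/stage55/HodgeCM/Model/HLiuOfSmallLevel.lean`, md5 ee04c857684a, 84 lines);
landed by the gen-22 packager (p-g22) in gate run 55 REPLACES the earlier landed copy of `HodgeCM/Model/HLiuOfSmallLevel.lean` (seat copy carried the packager Origin header of an earlier run (stripped)).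
-/
/-
RUN-37 `K`-ORDER TWIN by CONSTRUCTION seat `planner-pub-hodgecm-mc-axioms-1-g10-0` (unit pub-hodgecm-mc-axioms-1-g10, gen 10 of
mc-axioms-1, MODEL-DAG node N-i1 (L-lvl)), 2026-08-19, of the RUN-36 row `HodgeCM/Model/HLiuOfSmallLevel.lean` (kit t37-mcaxioms1g8 r2 #40
b1e619001660, booked RUN 36 (QQQQQ′)) — WHOLE-FILE REPLACEMENT of it as installed by RUN 36.
RE-TYPING OF RECORD (BINDER-TRIAGE §57/§58/§60; ±0 binders, no statement strengthened): the `hsmall` binder in the (W1)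
`K`-order `∃ Γ₀, ∀ Γ ≤ Γ₀, …` (was `∀ Γ, Γ.Γ ≤ Γ₀.Γ → …`; [Liu21] «K sufficiently small») — after this leaf E's residual on
the (L-lvl) line is THIS `hsmall` ONLY (BINDER-TRIAGE §58: P-PENDING → CITE [Liu21] on the (P-i) record; never a PROVE item).
`normOf`/`pushOf_comp_pull_eq_pull_normOf` of `Model/LevelTransferNorm` (RUN-36 row #38 7c48465cb65f) KEEP the `.Γ`-order.
ONE statement line changed vs the RUN-36 bytes; proof unchanged.
CONCLUSION = E's binder `hLiu` — `Model/E2InstanceR15A.lean` ″ 25ae7f12b9dc :86–:90 (= R10″ … R17A″) — BYTE-FOR-BYTE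
(glue-1-g6 2026-08-19T15:58:17Z: the row-9 bytes for RUN 37 ARE today's; its RUN-37 corollary leaf `Model/E2InstanceR18[A]`
takes this file's `hsmall` text verbatim and applies the wrapper inside its body — nothing of this lineage enters the parent
E term).  (W1) WORLD member: INSTALL in the SAME run as the (W1) root `CM/Basic.lean` #342 66bed69a8c74 (kit t37-mcglue1g6.txt)
and as this lineage's RUN-37 `LevelDescent` twin, after both; the four axioms-1 RUN-37 rows replace their installed twins
TOGETHER (none elaborates in a mixed world).
-/
/-
Origin: CONSTRUCTION seat `planner-pub-hodgecm-mc-axioms-1-g8-0` (unit pub-hodgecm-mc-axioms-1-g8, gen 8 of mc-axioms-1,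
MODEL-DAG node N-i1 (L-lvl); desk booking model2-g6 (AAAA′) 2026-08-19T08:32:39Z), 2026-08-19.  NEW additive leaf
`HodgeCM/Model/HLiuOfSmallLevel.lean`.  ″ (JOINT-CUT) WORLD member: imports the ″ row `HLiuOfNorm` (kit t36 #12, 555f8312671d)
and this lineage's `Model/LevelTransferNorm` (gen 8: the NORM HALF constructed).  Nothing imports this file (bounce-isolated).
No proof holes, no records, nothing cited.  Expected `#print axioms`: {propext, Classical.choice, Quot.sound}.
CONTENT: ONE theorem `HodgeCM.Model.hLiu_of_smallLevel` = the trade `hLiu ↦ hsmall` for E: the binder `hLiu` of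
`Model.perL_picardCM_rNcore` (conclusion VERBATIM from `HLiuOfNorm.lean` / `E2InstanceR10.lean`) follows from the
level-smallness hypothesis `hsmall` ALONE (plus E's own `h hA W S μ`), by `hLiu_of_norm` at the KERNEL norm half
`norm := normOf …`, `hnorm := pushOf_comp_pull_eq_pull_normOf …` of `Model/LevelTransferNorm.lean`.  After this leaf E's
residual on the (L-lvl) line is `hsmall` ONLY.
-/
import Summits.HodgeConjecture.HodgeCM.Model.HLiuOfNorm
import Summits.HodgeConjecture.HodgeCM.Model.LevelTransferNorm

/-! PORT of `HodgeCM/Model/HLiuOfSmallLevel.lean` (HodgeCMPerL run 82) — verbatim mechanical port; provenance in the PORT header line. -/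

noncomputable section

open scoped TensorProduct InnerProductSpace Matrix

namespace HodgeCM

namespace Model

open HodgeCM.Universe (AdelicThetaCore AdelicThetaCore₀ SideData ThetaModel ModelAxiomsPerL LevelTransfer)
open Literature.AlgebraicGeometry.Motives (CMType)
open Literature.AlgebraicGeometry.HodgeTheory
open Literature.AlgebraicGeometry.ComplexMultiplication (Shimura1998_Thm3_isogenousPower Shimura1998_Thm2_Cor)
open Literature.NumberTheory.Automorphic.PicardCM
open Literature.NumberTheory.Transcendental (Arapura2012_Cor_15_4_6)
open HodgeCM.CMTypeOps (inflate)
open HodgeCM.Model.SupplyResidual (ClassSupplyPackN)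
open HodgeCM.Model.ThetaSpace

variable (hHD : exists_isReal_hodgeModel) (hI : hodgePQ_independent_of_hodgeModel)
  (h₁ : BallQuotientUniformised)  (h₃ : CMAbelianVarietyRealised)

/-- `hLiu_of_smallLevel` — E's binder `hLiu` (conclusion; text VERBATIM from `E2InstanceR10.lean`) from the level-smallness
hypothesis `hsmall` in the (L-lvl) shape `∃ Γ₀ ∀ Γ ≤ Γ₀` ALONE: the level-transfer datum `D` of `hLiu_of_small` is now
KERNEL in both halves (`pushOf` — `deg •` the transfer of the finite covering `coverOf … (ℂ)`, `LevelTransferPush.lean`;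
`normOf` — the norm morphism along it, `LevelTransferNorm.lean`, with `pushOf ∘ₗ F^* = (normOf F)^*` on `H¹`).  Proof:
`hLiu_of_norm` at `norm := normOf`, `hnorm := pushOf_comp_pull_eq_pull_normOf`. -/
theorem hLiu_of_smallLevel (h : Bool) (hA : Arapura2012_Cor_15_4_6)
    (W : ∀ {L : CMField} {ι₁ : L →+* ℂ} (V : HermSpace3 L ι₁) (c : SeesawCtx L), WmInput V c.D)
    (S : ∀ {L : CMField} {ι₁ : L →+* ℂ} (V : HermSpace3 L ι₁) (c : SeesawCtx L), ThetaAdelicSide V c)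
    (μ : ∀ {L : CMField}, SeesawCtx L → Fin 4 → NumberField.InfinitePlace L → ℤ)
    (hsmall : ∀ {L : CMField} {ι₁ : L →+* ℂ} (V : HermSpace3 L ι₁) (c : SeesawCtx L),
      (thetaModelOf hHD hI h₁ h₃ h (embOf hHD hI h₁ h₃) (coverOf hHD hI h₁ h₃ hA) (wmOfInput W) (thetaOf _ (thetaClassInputOf _ (fun V c => thetaSpaceInputOf hHD hI h₁ h₃ S V c))) (d12Of μ) (d34Of μ)).GoodCtx ι₁ c → Module.finrank ℚ c.K = 6 →
      ∀ i : Fin 4, ∃ Γ₀ : Level V, ∀ Γ ≤ Γ₀,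
        ∃ (M : CMField) (k : c.K →+* M) (σ' : M →+* ℂ), σ'.comp k = c.σ ∧
        (thetaModelOf hHD hI h₁ h₃ h (embOf hHD hI h₁ h₃) (coverOf hHD hI h₁ h₃ hA) (wmOfInput W) (thetaOf _ (thetaClassInputOf _ (fun V c => thetaSpaceInputOf hHD hI h₁ h₃ S V c))) (d12Of μ) (d34Of μ)).Theta V c i Γ ⊆
          (picardCMUniverse hHD hI h₁ h₃).Uiso Γ M (inflate k (c.Ψ i)) σ') :
    ∀ {L : CMField} {ι₁ : L →+* ℂ} (V : HermSpace3 L ι₁) (c : SeesawCtx L),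
      (thetaModelOf hHD hI h₁ h₃ h (embOf hHD hI h₁ h₃) (coverOf hHD hI h₁ h₃ hA) (wmOfInput W) (thetaOf _ (thetaClassInputOf _ (fun V c => thetaSpaceInputOf hHD hI h₁ h₃ S V c))) (d12Of μ) (d34Of μ)).GoodCtx ι₁ c → Module.finrank ℚ c.K = 6 →
      ∀ (i : Fin 4) (Γ : Level V), ∃ (M : CMField) (k : c.K →+* M) (σ' : M →+* ℂ), σ'.comp k = c.σ ∧
        (thetaModelOf hHD hI h₁ h₃ h (embOf hHD hI h₁ h₃) (coverOf hHD hI h₁ h₃ hA) (wmOfInput W) (thetaOf _ (thetaClassInputOf _ (fun V c => thetaSpaceInputOf hHD hI h₁ h₃ S V c))) (d12Of μ) (d34Of μ)).Theta V c i Γ ⊆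
          (picardCMUniverse hHD hI h₁ h₃).Uiso Γ M (inflate k (c.Ψ i)) σ' :=
  hLiu_of_norm hHD hI h₁ h₃ h hA W S μ (normOf hHD hI h₁ h₃ hA)
    (pushOf_comp_pull_eq_pull_normOf hHD hI h₁ h₃ hA) hsmall

end Model

end HodgeCM

end
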